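import Mathlib
import Summits.NavierStokesRegularity.NavierStokesRegularity.Theorems.TypeIQuarterGateScarEnvelopeTypeISatelliteTowerRigidCensus
import Summits.NavierStokesRegularity.NavierStokesRegularity.Theorems.TypeIQuarterGateScarEnvelopeTypeISatelliteTowerEnvelopeTame
import Summits.NavierStokesRegularity.NavierStokesRegularity.Theorems.TypeIQuarterGateScarEnvelopeTypeISatelliteTowerRootCensus

/-!
# Satellite tower for crux `ScarEnvelopeTypeI` (stmt-NavierStokesRegularity-23843) — Part U1–U4: the root census in rigid form (TAME versus WILD doubly-minimal roots); root blow-ups carry every envelope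

Part U1–U4 of nsreg-p3's ROUND-40 artefact (section `RigidRoot`): U1 `RootBlowup`, `RootDescends.rootBlowup`, `DoublyMin.tame_or_sphere`,
`DoublyMin.root_step`; U2 `RigidRootDescent I`, `RigidRootDescent.infiniteRootDescent`, `RigidRootDescent.flat`; U3 `DoublyMin.root_census`,
`doublyMin_tame_or_rigidRootDescent`; U4 `LocEnv A δ n` / `EnvNode A n` (local / unit-window KNSS envelopes about the root), `LocEnv.rateAt`,
`ExactCrit.levelCrit_le_of_locEnv`, `EnvNode.tameRoot`, `EnvNode.regPt`, `envNode_of_ae_le(_windows)`, `envNode_of_ae_eq_decay`, ★ `DoublyMin.blowup_root`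
(every local envelope of a doubly-minimal object becomes a unit-window envelope, same constant, of every root blow-up), `DoublyMin.tame_blowup`,
`DoublyMin.exists_tameLeaf`, `DoublyMin.tameTower`.

PROVENANCE: declaration texts VERBATIM from the HOME artefact of the instrument seat nsreg-p3 g27 (cell `pub/ns-regularity-ideate`):
`round-40/Root40.lean` (sha16 `d3d4255074edfeef`, NEW part `partU.lean`; a standalone module written against the TREE;
memo `round-40/ROUND-40.md` c4a2dbdad86380a6), scored PASS ★★ by referee ref3 g27 (`SCORE-p3-ROUND-40-0828.md` 41a324c979557729); the author cannot write under `Theorems/`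
(`perm.theorems-prover-only`); landed by the prover ns-es-p1 g5 as landing hand of record (director-ns DIRECTOR-NS #237 (3)), split into
≤ 400-line modules, `E3` spelled out, the artefact's `#guard_msgs … #print axioms` certificates not landed.
`--supports stmt-NavierStokesRegularity-23843 --as helper`.

HONEST FRAMING: instrument theorems about HYPOTHETICAL Type-I zoom limits (Albritton–Barker objects of the census of crux
`TypeIQuarterGate.ScarEnvelopeTypeI`, item 23843); the analytic input is the tree's closure engine (compactness
`local_typeI_compactness_twin_inBall`, sharpened to constant 1 in Part S1; Q1 whole-space), P1 rate inheritance, L8 persistence and the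
tree's PROVED small-constant Liouville theorem; Parts R/S are order theory on the re-classing and closure lemmas.  NOTHING OPEN IS
PROVED: 23843, (L′) `TypeILiouvilleAB` / (L′₀), the GLOBAL (S∞) = `CritAttained`, (M𝐈₁), (E1⁺), (E2ᵣ), route ExtremalTypeIConstant's
cruxes, N0 and Navier–Stokes regularity are OPEN; `critRate`, `levelCrit I`, `liouvilleRate` are `sInf`s that are `0` by junk value
when the defining set is empty (every statement using them carries the nonemptiness hypothesis explicitly).
-/

-- the summit-side namespace repeats a component by design (single-conjunct summit, D-0017)
set_option linter.dupNamespace false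

open MeasureTheory Set Metric Filter Topology
open scoped ENNReal NNReal InnerProductSpace
open Literature.Analysis.FluidPDE

namespace Summit.NavierStokesRegularity.NavierStokesRegularity.Cruxes.ScarEnvelopeTypeI.ZoomDictionary

section RigidRoot

variable {U : ℝ → (EuclideanSpace ℝ (Fin 3)) → (EuclideanSpace ℝ (Fin 3))} {P : ℝ → (EuclideanSpace ℝ (Fin 3)) → ℝ}

/-- A **ROOT BLOW-UP** `n ↝ n'`: the field of `n'` is, a.e. on every `Q_R(0)`, `R < 1`, a tangent flow of
the field of `n` AT ITS ROOT `(0,0)` (the tree's `RootDescends` without the satellite clause). -/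
def RootBlowup (n n' : TNode) : Prop :=
  ∃ (L : ℕ → ℝ) (Ū : ℝ → (EuclideanSpace ℝ (Fin 3)) → (EuclideanSpace ℝ (Fin 3))), TangentU n.U n.P 0 0 L Ū ∧
    ∀ R ∈ Ioo (0 : ℝ) 1,
      ∀ᵐ z ∂(volume.restrict (parabolicCylinder R (0 : ℝ × (EuclideanSpace ℝ (Fin 3))))), Ū z.1 z.2 = n'.U z.1 z.2

/-- A root descent step `n ⟶ n'` is in particular a root blow-up `n ↝ n'`. -/
theorem RootDescends.rootBlowup {n n' : TNode} (h : RootDescends n n') : RootBlowup n n' := by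
  obtain ⟨L, Ū, hŪ, hid, -, -⟩ := h
  exact ⟨L, Ū, hŪ, hid⟩

/-- ★ **U1. THE ROOT METER INSIDE THE DOUBLY-MINIMAL FAMILY.**  A doubly-minimal object is TAME at its
root, or — for every `κ > 1` — some ROOT blow-up of it is a doubly-minimal object OF THE SAME LEVEL carrying
a satellite on the sphere `‖y‖ = κ⁻¹` (root meter M3 + T5b + L8 persistence through the identification). -/
theorem DoublyMin.tame_or_sphere {I : ℝ≥0∞} {n : TNode} (h : DoublyMin I n) {κ : ℝ} (hκ : 1 < κ) :
    TameRoot n ∨ ∃ n' : TNode, DoublyMin I n' ∧ n'.level = n.level ∧ RootBlowup n n' ∧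
      ‖n'.y‖ = κ⁻¹ ∧ n'.y ∈ satellites n'.U := by
  by_cases hb : TameRoot n
  · exact Or.inl hb
  right
  obtain ⟨L, Ū, hŪ, z, hz, hreg⟩ := h.1.1.1.sphere_of_not_budgetAt hb hκ
  obtain ⟨hz0, hz1⟩ := sphere_aux hκ hz
  obtain ⟨n', hD', hlev, hy', hid, -⟩ := h.blowup h.1.1.2 hŪ z
  have hz' : ¬ RegPt n'.U z := fun hr => hreg ((regPt_iff_of_ae_eq_of_norm_lt_one hid hz1).2 hr)
  refine ⟨n', hD', hlev, ⟨L, Ū, hŪ, hid⟩, ?_, ?_⟩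
  · rw [hy']; exact hz
  · rw [hy']; exact ⟨hz0, hz'⟩

/-- U1b. At `κ = 4` this is the tree's `RootDescends` step, inside the doubly-minimal family. -/
theorem DoublyMin.root_step {I : ℝ≥0∞} {n : TNode} (h : DoublyMin I n) :
    TameRoot n ∨ ∃ n' : TNode, DoublyMin I n' ∧ n'.level = n.level ∧ RootDescends n n' := by
  have h4 : (1 : ℝ) < 4 := by norm_num
  rcases h.tame_or_sphere h4 with hb | ⟨n', hD', hlev, ⟨L, Ū, hŪ, hid⟩, hz, hsat⟩
  · exact Or.inl hb
  · have hz4 : ‖n'.y‖ = 1 / 4 := by rw [hz]; norm_num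
    exact Or.inr ⟨n', hD', hlev, L, Ū, hŪ, hid, hz4, hsat⟩

/-- A **RIGID ROOT DESCENT** at the level `I`: an infinite ROOT descent (tree currency `RootDescends`:
each level is a.e. a tangent flow of the previous one AT ITS ROOT and carries a satellite on the sphere
`‖y‖ = 1/4`) all of whose levels are DOUBLY-MINIMAL and NON-tame at the root — hence of constant class
`M_c(I)`, constant energy `minLevel I`, and with root (and every) scar rated EXACTLY `M_c(I)`. -/
def RigidRootDescent (I : ℝ≥0∞) : Prop :=
  ∃ c : ℕ → TNode, ∀ k, DoublyMin I (c k) ∧ ¬ TameRoot (c k) ∧ RootDescends (c k) (c (k + 1))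

/-- U2a. A rigid root descent is an infinite root descent (E2ᵣ) of the class `M_c(I)`. -/
theorem RigidRootDescent.infiniteRootDescent {I : ℝ≥0∞} (h : RigidRootDescent I) :
    InfiniteRootDescent (levelCrit I) := by
  obtain ⟨c, hc⟩ := h
  exact ⟨c, fun k => ⟨(hc k).1.1.1, (hc k).2.1, (hc k).2.2⟩⟩

/-- U2b. FLATNESS: along a rigid root descent the root rates are all EXACTLY `M_c(I)` and the energies
all EXACTLY `minLevel I` (compare the tree's `rootRate_antitone` / `rootRate_trap'`: non-increasing,
convergent to a limit `≥ ε_L` — here the ladder does not move at all). -/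
theorem RigidRootDescent.flat {I : ℝ≥0∞} {c : ℕ → TNode}
    (hc : ∀ k, DoublyMin I (c k) ∧ ¬ TameRoot (c k) ∧ RootDescends (c k) (c (k + 1))) (k : ℕ) :
    tightRate (c k).U 0 = levelCrit I ∧ (c k).level = minLevel I ∧
      (∀ y : (EuclideanSpace ℝ (Fin 3)), ¬ RegPt (c k).U y → tightRate (c k).U y = levelCrit I) :=
  ⟨(hc k).1.1.tightRate_eq (hc k).1.1.1.2, (hc k).1.2, fun _ hy => (hc k).1.1.tightRate_eq hy⟩

/-- ★★ **U3. THE ROOT CENSUS INSIDE THE DOUBLY-MINIMAL FAMILY** (tree `chain_dichotomy` driven by U1b):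
at every finite scar-carrying level, from every doubly-minimal object, EITHER finitely many root blow-ups
inside the family reach a doubly-minimal object TAME at its root, OR the root blow-ups go on for ever: a
RIGID ROOT DESCENT starting at the given object. -/
theorem DoublyMin.root_census {I : ℝ≥0∞} {n₀ : TNode} (h₀ : DoublyMin I n₀) :
    (∃ (c : ℕ → TNode) (k : ℕ), c 0 = n₀ ∧ (∀ i < k, RootDescends (c i) (c (i + 1))) ∧
        (∀ i ≤ k, DoublyMin I (c i)) ∧ TameRoot (c k)) ∨
      ∃ c : ℕ → TNode, c 0 = n₀ ∧ ∀ k, DoublyMin I (c k) ∧ ¬ TameRoot (c k) ∧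
        RootDescends (c k) (c (k + 1)) :=
  chain_dichotomy (DoublyMin I) TameRoot RootDescends
    (fun _ ha => (DoublyMin.root_step ha).imp_right fun ⟨b, hb, _, hr⟩ => ⟨b, hb, hr⟩) h₀

/-- U3 census inside the doubly-minimal family of a finite scar-carrying level: a TAME doubly-minimal object, or a RIGID ROOT DESCENT. -/
theorem doublyMin_tame_or_rigidRootDescent {I : ℝ≥0∞} (hI : I < ⊤) (hne : (levelRates I).Nonempty) :
    (∃ n : TNode, DoublyMin I n ∧ TameRoot n) ∨ RigidRootDescent I := by
  obtain ⟨n₀, h₀⟩ := doublyMin_nonempty hI hne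
  rcases h₀.root_census with ⟨c, k, -, -, hN, hG⟩ | ⟨c, -, hc⟩
  · exact Or.inl ⟨c k, hN k le_rfl, hG⟩
  · exact Or.inr ⟨c, hc⟩

/-! #### U4. ROOT BLOW-UPS CARRY EVERY ENVELOPE; TAME DOUBLY-MINIMAL ROOTS REPRODUCE -/

/-- A node is **`(A, δ)`-ENVELOPED**: the KNSS space–time envelope `‖U(t,x)‖ ≤ A / (‖x‖ + √(-t))` holds
on the window `(-δ², 0) × B_δ(0)` about its root (the tree's local envelope at `y' = 0`). -/
def LocEnv (A δ : ℝ) (n : TNode) : Prop :=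
  ∀ t ∈ Ioo (-(δ ^ 2)) 0, ∀ x ∈ ball (0 : (EuclideanSpace ℝ (Fin 3))) δ, ‖n.U t x‖ ≤ A / (‖x‖ + Real.sqrt (-t))

/-- A node is **`A`-ENVELOPED** when it is `(A, 1)`-enveloped: the envelope holds on the open UNIT window
about its root — the LOCAL form, at the root of the node, of the conclusion of 23843. -/
def EnvNode (A : ℝ) (n : TNode) : Prop := LocEnv A 1 n

/-- Unfolding of `EnvNode A n`: the KNSS envelope `‖U(t,x)‖ ≤ A/(‖x‖ + √(-t))` on the unit window about the root. -/
theorem envNode_iff {A : ℝ} {n : TNode} :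
    EnvNode A n ↔ ∀ t ∈ Ioo (-1 : ℝ) 0, ∀ x ∈ ball (0 : (EuclideanSpace ℝ (Fin 3))) 1, ‖n.U t x‖ ≤ A / (‖x‖ + Real.sqrt (-t)) := by
  simp [EnvNode, LocEnv]

/-- The tree's spelling (`‖x - 0‖`) of a local envelope at the root. -/
theorem locEnv_iff {A δ : ℝ} {n : TNode} :
    LocEnv A δ n ↔ ∀ t ∈ Ioo (-(δ ^ 2)) 0, ∀ x ∈ ball (0 : (EuclideanSpace ℝ (Fin 3))) δ,
      ‖n.U t x‖ ≤ A / (‖x - 0‖ + Real.sqrt (-t)) := by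
  simp only [LocEnv, sub_zero]

/-- Envelopes restrict to smaller windows. -/
theorem LocEnv.mono {A δ δ' : ℝ} {n : TNode} (h : LocEnv A δ n) (hδ' : 0 < δ') (hle : δ' ≤ δ) :
    LocEnv A δ' n := fun t ht x hx =>
  h t ⟨lt_of_le_of_lt (by nlinarith) ht.1, ht.2⟩ x (ball_subset_ball hle hx)

/-- An envelope constant is nonnegative. -/
theorem LocEnv.nonneg {A δ : ℝ} {n : TNode} (h : LocEnv A δ n) (hδ : 0 < δ) : 0 ≤ A := by
  have ht : (-(δ ^ 2) / 4 : ℝ) ∈ Ioo (-(δ ^ 2)) 0 := ⟨by nlinarith, by nlinarith⟩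
  have h1 := h _ ht 0 (mem_ball_self hδ)
  have hs : 0 < Real.sqrt (-(-(δ ^ 2) / 4)) := Real.sqrt_pos.2 (by nlinarith)
  rw [norm_zero, zero_add] at h1
  by_contra hA
  exact absurd ((norm_nonneg _).trans h1) (not_le.2 (div_neg_of_neg_of_pos (not_le.1 hA) hs))

/-- An `(A, δ)`-envelope at the root is a local sup-norm rate `A` at the root. -/
theorem LocEnv.rateAt {A δ : ℝ} {n : TNode} (h : LocEnv A δ n) (hδ : 0 < δ) : RateAt A n.U 0 := by
  have hA : 0 ≤ A := h.nonneg hδ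
  refine ⟨δ, hδ, fun t ht x hx => ?_⟩
  have hs : 0 < Real.sqrt (-t) := Real.sqrt_pos.2 (by linarith [ht.2])
  have hden : 0 < ‖x‖ + Real.sqrt (-t) := add_pos_of_nonneg_of_pos (norm_nonneg _) hs
  calc Real.sqrt (-t) * ‖n.U t x‖ ≤ Real.sqrt (-t) * (A / (‖x‖ + Real.sqrt (-t))) :=
        mul_le_mul_of_nonneg_left (h t ht x hx) hs.le
    _ ≤ (‖x‖ + Real.sqrt (-t)) * (A / (‖x‖ + Real.sqrt (-t))) :=
        mul_le_mul_of_nonneg_right (le_add_of_nonneg_left (norm_nonneg _)) (div_nonneg hA hden.le)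
    _ = A := by field_simp

/-- Hence every envelope constant at the root of an exactly-critical object is `≥ M_c(I)` (T3 exactness). -/
theorem ExactCrit.levelCrit_le_of_locEnv {I : ℝ≥0∞} {n : TNode} (h : ExactCrit I n) {A δ : ℝ}
    (hδ : 0 < δ) (henv : LocEnv A δ n) : levelCrit I ≤ A := by
  rw [← h.tightRate_eq h.1.2]
  exact tightRate_le_of_rateAt (henv.rateAt hδ)

/-- An enveloped A–B node is tame at its root (tree `ABTower.budgetAt_of_envelope`). -/
theorem LocEnv.tameRoot {A δ M : ℝ} {n : TNode} (hAB : ABTower M n.U n.P n.H) (h : LocEnv A δ n)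
    (hδ : 0 < δ) : TameRoot n :=
  hAB.budgetAt_of_envelope hδ (locEnv_iff.1 h)

/-- A unit-window enveloped A–B object is TAME at the root. -/
theorem EnvNode.tameRoot {A M : ℝ} {n : TNode} (hAB : ABTower M n.U n.P n.H) (h : EnvNode A n) :
    TameRoot n :=
  LocEnv.tameRoot hAB h one_pos

/-- An enveloped node has no satellite in the punctured ball of radius `1/2` (tree `regPt_of_localEnvelope`). -/
theorem EnvNode.regPt {A : ℝ} {n : TNode} (h : EnvNode A n) {y : (EuclideanSpace ℝ (Fin 3))} (hy0 : y ≠ 0) (hy : ‖y‖ < 1 / 2) :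
    RegPt n.U y :=
  regPt_of_localEnvelope one_pos (locEnv_iff.1 h) hy0 (by simpa using hy)

/-- **From an a.e. envelope to an envelope.**  A–B objects are smooth on the open past
(`IsTypeIAncientMild`), so an a.e. envelope on the (open) unit window holds everywhere on it (tree
`norm_le_of_ae_le_of_continuousOn`). -/
theorem envNode_of_ae_le {A M : ℝ} {n : TNode} (hAB : ABTower M n.U n.P n.H)
    (h : ∀ᵐ z ∂(volume.restrict (parabolicCylinder 1 (0 : ℝ × (EuclideanSpace ℝ (Fin 3))))),
      ‖n.U z.1 z.2‖ ≤ A / (‖z.2‖ + Real.sqrt (-z.1))) :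
    EnvNode A n := by
  have hneg : ∀ z ∈ parabolicCylinder (1 : ℝ) (0 : ℝ × (EuclideanSpace ℝ (Fin 3))), z.1 < 0 := fun z hz => by
    simpa using (mem_prod.1 hz).1.2
  have hsub : parabolicCylinder (1 : ℝ) (0 : ℝ × (EuclideanSpace ℝ (Fin 3))) ⊆ Iio (0 : ℝ) ×ˢ (univ : Set (EuclideanSpace ℝ (Fin 3))) := fun z hz =>
    ⟨mem_Iio.2 (hneg z hz), mem_univ _⟩
  have hcont : ContinuousOn (Function.uncurry n.U) (parabolicCylinder (1 : ℝ) (0 : ℝ × (EuclideanSpace ℝ (Fin 3)))) :=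
    (hAB.1.1.continuousOn).mono hsub
  have hg : ContinuousOn (fun z : ℝ × (EuclideanSpace ℝ (Fin 3)) => A / (‖z.2‖ + Real.sqrt (-z.1)))
      (parabolicCylinder (1 : ℝ) (0 : ℝ × (EuclideanSpace ℝ (Fin 3)))) := by
    refine ContinuousOn.div continuousOn_const
      (continuous_snd.norm.add (continuous_fst.neg.sqrt)).continuousOn ?_
    intro z hz
    exact (add_pos_of_nonneg_of_pos (norm_nonneg _)
      (Real.sqrt_pos.2 (neg_pos.2 (hneg z hz)))).ne'
  have key := norm_le_of_ae_le_of_continuousOn (isOpen_parabolicCylinder _ _) hcont hg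
    (h.mono fun z hz => hz)
  rw [envNode_iff]
  intro t ht x hx
  have hmem : ((t, x) : ℝ × (EuclideanSpace ℝ (Fin 3))) ∈ parabolicCylinder (1 : ℝ) (0 : ℝ × (EuclideanSpace ℝ (Fin 3))) :=
    mem_prod.2 ⟨by simpa using ht, by simpa using hx⟩
  simpa using key (t, x) hmem

/-- The same from a.e. envelopes on the windows `Q_R(0)`, `R < 1` (every point of the open unit window lies
in one of them). -/
theorem envNode_of_ae_le_windows {A M : ℝ} {n : TNode} (hAB : ABTower M n.U n.P n.H)
    (h : ∀ R ∈ Ioo (0 : ℝ) 1, ∀ᵐ z ∂(volume.restrict (parabolicCylinder R (0 : ℝ × (EuclideanSpace ℝ (Fin 3))))),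
      ‖n.U z.1 z.2‖ ≤ A / (‖z.2‖ + Real.sqrt (-z.1))) :
    EnvNode A n := by
  refine envNode_of_ae_le hAB ?_
  -- `Q_1(0)` is the increasing union of the `Q_{R_k}(0)`, `R_k = 1 - 1/(k+2)`
  set Rk : ℕ → ℝ := fun k => 1 - 1 / ((k : ℝ) + 2) with hRk
  have hRk0 : ∀ k, 0 < Rk k := fun k => by
    have : (1 : ℝ) / ((k : ℝ) + 2) < 1 := by
      rw [div_lt_one (by positivity)]; linarith [(Nat.cast_nonneg k : (0 : ℝ) ≤ k)]
    simp only [hRk]; linarith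
  have hRk1 : ∀ k, Rk k < 1 := fun k => by
    have : 0 < (1 : ℝ) / ((k : ℝ) + 2) := by positivity
    simp only [hRk]; linarith
  have hcover : parabolicCylinder (1 : ℝ) (0 : ℝ × (EuclideanSpace ℝ (Fin 3))) ⊆ ⋃ k : ℕ, parabolicCylinder (Rk k) (0 : ℝ × (EuclideanSpace ℝ (Fin 3))) := by
    rintro ⟨t, x⟩ hz
    obtain ⟨⟨ht1, ht0⟩, hx⟩ := mem_prod.1 hz
    simp only [Prod.fst_zero, one_pow, zero_sub] at ht1 ht0
    rw [Prod.snd_zero, mem_ball_zero_iff] at hx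
    have hst : Real.sqrt (-t) < 1 := by
      rw [show (1 : ℝ) = Real.sqrt 1 by rw [Real.sqrt_one]]
      exact Real.sqrt_lt_sqrt (by linarith) (by linarith)
    set m : ℝ := max ‖x‖ (Real.sqrt (-t)) with hm
    have hm1 : m < 1 := max_lt hx hst
    obtain ⟨k, hk⟩ := exists_nat_gt (1 / (1 - m))
    have hkpos : (0 : ℝ) < 1 - m := by linarith
    have hmR : m < Rk k := by
      simp only [hRk]
      have h2 : 1 / ((k : ℝ) + 2) < 1 - m := by
        rw [div_lt_iff₀ (by positivity)]
        have h3 : 1 < (1 - m) * k := by rwa [div_lt_iff₀ hkpos, mul_comm] at hk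
        nlinarith
      linarith
    refine mem_iUnion.2 ⟨k, mem_prod.2 ⟨⟨?_, ?_⟩, ?_⟩⟩
    · have h1 : Real.sqrt (-t) < Rk k := lt_of_le_of_lt (le_max_right _ _) hmR
      have h2 : -t < Rk k ^ 2 := by
        have h3 := (Real.sqrt_lt' (hRk0 k)).1 h1
        linarith
      simpa using (by linarith : (0 : ℝ) - Rk k ^ 2 < t)
    · simpa using ht0
    · rw [Prod.snd_zero, mem_ball_zero_iff]
      exact lt_of_le_of_lt (le_max_left _ _) hmR
  have hQ : ∀ k, ∀ᵐ z ∂(volume.restrict (parabolicCylinder (Rk k) (0 : ℝ × (EuclideanSpace ℝ (Fin 3))))),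
      ‖n.U z.1 z.2‖ ≤ A / (‖z.2‖ + Real.sqrt (-z.1)) := fun k => h (Rk k) ⟨hRk0 k, hRk1 k⟩
  exact ae_restrict_of_ae_restrict_of_subset hcover ((ae_restrict_iUnion_iff _ _).2 hQ)

/-- **The envelope passes through the identification**: if an A–B node agrees a.e. on every `Q_R(0)`,
`R < 1`, with a field obeying the GLOBAL envelope `HasTypeIDecay A`, it is `A`-enveloped. -/
theorem envNode_of_ae_eq_decay {A M : ℝ} {n' : TNode} (hAB : ABTower M n'.U n'.P n'.H)
    {U' : ℝ → (EuclideanSpace ℝ (Fin 3)) → (EuclideanSpace ℝ (Fin 3))} (hdec : HasTypeIDecay A U')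
    (hae : ∀ R ∈ Ioo (0 : ℝ) 1,
      ∀ᵐ z ∂(volume.restrict (parabolicCylinder R (0 : ℝ × (EuclideanSpace ℝ (Fin 3))))), U' z.1 z.2 = n'.U z.1 z.2) :
    EnvNode A n' := by
  refine envNode_of_ae_le_windows hAB fun R hR => ?_
  filter_upwards [hae R hR, ae_restrict_mem (isOpen_parabolicCylinder _ _).measurableSet] with z h1 hz
  have hneg : z.1 < 0 := by simpa using (mem_prod.1 hz).1.2
  rw [← h1]
  exact hdec z.1 hneg z.2

/-- ★★ **U4. ROOT BLOW-UPS OF DOUBLY-MINIMAL OBJECTS CARRY EVERY ENVELOPE TO THE WHOLE UNIT WINDOW.**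
For a doubly-minimal object `n` and ANY root blow-up (T5b: a doubly-minimal object `n'` of the same level,
root rated exactly `M_c(I)`): EVERY local envelope `(A, δ)` of `n` at its root, at ANY radius `δ > 0`,
becomes an envelope of `n'` with the SAME constant `A` on the whole UNIT window (the envelope is
scale-invariant: tree `abTower_closed_decay` gives it globally for the decaying representative, and it
passes to `n'` through the a.e. identification by smoothness).  If `n` is tame, `n'` is moreover a ONE-SCAR
LEAF (class dictionary `towerDictionary_inBall`) and again TAME. -/
theorem DoublyMin.blowup_root {I : ℝ≥0∞} {n : TNode} (h : DoublyMin I n)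
    {L : ℕ → ℝ} {Ū : ℝ → (EuclideanSpace ℝ (Fin 3)) → (EuclideanSpace ℝ (Fin 3))} (hŪ : TangentU n.U n.P 0 0 L Ū) :
    ∃ n' : TNode, DoublyMin I n' ∧ n'.level = n.level ∧ n'.y = 0 ∧
      (∀ R ∈ Ioo (0 : ℝ) 1,
        ∀ᵐ z ∂(volume.restrict (parabolicCylinder R (0 : ℝ × (EuclideanSpace ℝ (Fin 3))))), Ū z.1 z.2 = n'.U z.1 z.2) ∧
      tightRate n'.U 0 = levelCrit I ∧
      (∀ A δ : ℝ, 0 < δ → LocEnv A δ n → EnvNode A n') ∧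
      (TameRoot n → LeafNode n' ∧ TameRoot n') := by
  obtain ⟨n', hD', hlev, hy', hid, hex⟩ := h.blowup h.1.1.2 hŪ 0
  have hT : TowerObj (levelCrit I) n.U n.P := towerObj_of_abTower h.1.1.1
  have henv' : ∀ A δ : ℝ, 0 < δ → LocEnv A δ n → EnvNode A n' := by
    intro A δ hδ hAδ
    obtain ⟨U', P', H', -, hdec, hae'⟩ := abTower_closed_decay h.1.1.1 hŪ hδ (locEnv_iff.1 hAδ)
    exact envNode_of_ae_eq_decay hD'.1.1.1 hdec fun R hR => by
      filter_upwards [hid R hR, hae' R hR] with z h1 h2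
      rw [← h2, h1]
  have hleaf : TameRoot n → LeafNode n' := fun hb y hy0 hy1 =>
    (regPt_iff_of_ae_eq_of_norm_lt_one hid hy1).1 ((towerDictionary_inBall hT 0).1 hb L Ū hŪ y hy0 hy1)
  refine ⟨n', hD', hlev, hy', hid, hex 0 hD'.1.1.2, henv', fun hb => ⟨hleaf hb, ?_⟩⟩
  obtain ⟨A, δ, hδ, hAδ⟩ := hT.envelope_of_budgetAt hb
  exact (henv' A δ hδ (locEnv_iff.2 hAδ)).tameRoot hD'.1.1.1

/-- ★★ U4b. **TAME DOUBLY-MINIMAL ROOTS REPRODUCE** as TAME, ENVELOPED, ONE-SCAR doubly-minimal LEAVES of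
the same level under every root blow-up. -/
theorem DoublyMin.tame_blowup {I : ℝ≥0∞} {n : TNode} (h : DoublyMin I n) (hb : TameRoot n)
    {L : ℕ → ℝ} {Ū : ℝ → (EuclideanSpace ℝ (Fin 3)) → (EuclideanSpace ℝ (Fin 3))} (hŪ : TangentU n.U n.P 0 0 L Ū) :
    ∃ n' : TNode, DoublyMin I n' ∧ n'.level = n.level ∧ n'.y = 0 ∧
      (∀ R ∈ Ioo (0 : ℝ) 1,
        ∀ᵐ z ∂(volume.restrict (parabolicCylinder R (0 : ℝ × (EuclideanSpace ℝ (Fin 3))))), Ū z.1 z.2 = n'.U z.1 z.2) ∧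
      LeafNode n' ∧ (∃ A : ℝ, EnvNode A n') ∧ TameRoot n' ∧ tightRate n'.U 0 = levelCrit I := by
  obtain ⟨n', hD', hlev, hy', hid, hex, henv', htame⟩ := h.blowup_root hŪ
  obtain ⟨A, δ, hδ, hAδ⟩ := (towerObj_of_abTower h.1.1.1).envelope_of_budgetAt hb
  exact ⟨n', hD', hlev, hy', hid, (htame hb).1, ⟨A, henv' A δ hδ (locEnv_iff.2 hAδ)⟩, (htame hb).2,
    hex⟩

/-- U4c. Hence a tame doubly-minimal object yields a TAME, ENVELOPED, ONE-SCAR doubly-minimal LEAF of the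
same level (root tangents exist: K12 `exists_tangentU_of_towerObj`). -/
theorem DoublyMin.exists_tameLeaf {I : ℝ≥0∞} {n : TNode} (h : DoublyMin I n) (hb : TameRoot n) :
    ∃ n' : TNode, DoublyMin I n' ∧ n'.level = n.level ∧ RootBlowup n n' ∧
      LeafNode n' ∧ (∃ A : ℝ, EnvNode A n') ∧ TameRoot n' := by
  obtain ⟨L, Ū, hŪ⟩ := exists_tangentU_of_towerObj (towerObj_of_abTower h.1.1.1) 0
  obtain ⟨n', hD', hlev, -, hid, hleaf, hA, hb', -⟩ := h.tame_blowup hb hŪ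
  exact ⟨n', hD', hlev, ⟨L, Ū, hŪ, hid⟩, hleaf, hA, hb'⟩

/-- U4d. ITERATION: from a tame doubly-minimal object, an infinite chain of ROOT blow-ups ALL of whose
levels are tame, enveloped, one-scar doubly-minimal leaves of the same energy — a RIGID TAME TOWER
(dependent choice on U4c). -/
theorem DoublyMin.tameTower {I : ℝ≥0∞} {n₀ : TNode} (h₀ : DoublyMin I n₀) (hb₀ : TameRoot n₀) :
    ∃ c : ℕ → TNode, c 0 = n₀ ∧ ∀ k, DoublyMin I (c (k + 1)) ∧ (c (k + 1)).level = n₀.level ∧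
      RootBlowup (c k) (c (k + 1)) ∧ LeafNode (c (k + 1)) ∧ (∃ A : ℝ, EnvNode A (c (k + 1))) ∧
      TameRoot (c (k + 1)) := by
  classical
  let S := {n : TNode // DoublyMin I n ∧ TameRoot n ∧ n.level = n₀.level}
  have hnext : ∀ d : S, ∃ d' : S, RootBlowup d.1 d'.1 ∧ LeafNode d'.1 ∧ ∃ A : ℝ, EnvNode A d'.1 := by
    rintro ⟨d, hd, hbd, hld⟩
    obtain ⟨n', hD', hlev, hrb, hleaf, hA, hb'⟩ := hd.exists_tameLeaf hbd
    exact ⟨⟨n', hD', hb', hlev.trans hld⟩, hrb, hleaf, hA⟩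
  choose next hnext using hnext
  let d₀ : S := ⟨n₀, h₀, hb₀, rfl⟩
  let f : ℕ → S := fun k => Nat.rec d₀ (fun _ d => next d) k
  have hf : ∀ k, f (k + 1) = next (f k) := fun k => rfl
  refine ⟨fun k => (f k).1, rfl, fun k => ?_⟩
  have h1 := hnext (f k)
  rw [← hf k] at h1
  exact ⟨(f (k + 1)).2.1, (f (k + 1)).2.2.2, h1.1, h1.2.1, h1.2.2, (f (k + 1)).2.2.1⟩

end RigidRoot

end Summit.NavierStokesRegularity.NavierStokesRegularity.Cruxes.ScarEnvelopeTypeI.ZoomDictionary
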